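import Summits.HodgeConjecture.HodgeConjecture.Theses.AnchorTransport
import Summits.HodgeConjecture.HodgeConjecture.Theorems.AnchorTransportVariationalHodgeCurveBase
import Literature.AlgebraicGeometry.HodgeTheory.GlobalInvariantCycles
import Literature.AlgebraicGeometry.HodgeTheory.LefschetzOneOneHolds
import Literature.AlgebraicGeometry.HodgeTheory.HardLefschetzNFoldHolds
import Literature.AlgebraicGeometry.Motives.CurveThroughTwoPointsProofs

/-!
# Route AnchorTransport — `VariationalHodge` (stmt-HodgeConjecture-1076): the typed codimension split (glue, lossless)

Crux-strategist re-exam of the RESTATED deciding crux (unit `cstrat-stmt-HodgeConjecture-1076-r1`,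
2026-08-17). Grothendieck's variational Hodge crux `AnchorTransport.VariationalHodge` (smooth PROPER
families with projective fibres over smooth irreducible bases, every codimension `p`) is concluded BY
NAME from three children, spelled out verbatim as hypotheses so that the theorem can serve as the
`--glue-by` of `ledger route edit --split VariationalHodge` (the children become the route's leaves and
the crux a derived node):

* `C₁` — **codimension 2, quasi-projective total space** (`p = 2`, `𝒳` admits an open immersion into a
  projective `ℂ`-scheme — the inlined `IsQuasiProjectiveOver 𝒳`, `codimSplit_isQuasiProjectiveOver_iff` —,
  smooth irreducible AFFINE bases, every relative dimension `n`): the first open arena of the printed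
  conjecture (Charles–Schnell Conj. 11.3.1 is about projective morphisms; proper + quasi-projective total
  space = projective in Hartshorne's sense, `exists_isClosedImmersion_of_isQuasiProjectiveOver`), and
  verbatim the residual-free reach `VariationalHodgeTwoAffineAll` of the registered line
  `Cruxes/VariationalHodge/Lines/polar_patch_broken_cycles.lean`;
* `C₂` — **codimension 2, NON-quasi-projective total space** (`p = 2`, `n ≥ 4`, smooth irreducible affine
  CURVE bases): the modelling residue of the decl (smooth proper families of K3-type fibres obtained as
  mixed small resolutions of nodal pencils are not projective over any neighbourhood of the special point —
  Atiyah 1958; isolated by `variationalHodge_of_projective_of_isQuasiProjectiveOver`);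
* `C₃` — **codimension `3 ≤ p ≤ n - 2`** (smooth irreducible affine curve bases, any total space): the open
  remainder of Grothendieck's conjecture beyond surfaces-in-fourfolds numerology, whose only engine on
  record is the motivic one (standard conjecture `B` ⇒ `V`, André 1996 Thm. 0.5 + §2.1;
  `variationalHodge_quasiProjective_of_standardConjectureB`).

Everything else is the tree's theorems, now UNCONDITIONAL: the reduction to smooth irreducible affine
curve bases and to the middle range `2 ≤ p ≤ n - 2` (`variationalHodge_of_residual`, fed with the
discharged facts `lefschetzOneOne_rational_holds`, `nonempty_hardLefschetzNFold_holds`,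
`mumford_smoothCurve_through_two_points_holds`), and the case split `p = 2 ∨ 3 ≤ p`,
quasi-projective or not.

* `variationalHodge_of_codimSplit : C₁ → C₂ → C₃ → VariationalHodge` — the GLUE;
* `variationalHodge_iff_codimSplit : VariationalHodge ↔ C₁ ∧ C₂ ∧ C₃` — the split is LOSSLESS (each
  child is the crux restricted, hence `HodgeConjecture`-implied like the crux, and no child is stronger
  than the crux).

This is the route-split recommended by the line leads c1-0/c2-0 (evidence `RouteSplitProposal.lean`,
`PolarPatchBrokenCycles.variationalHodge_iff_twoAffineAll_and_residual`), by the crux-plan planner of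
`polar-patch-broken-cycles` and by prover seats -2/0 (verdict-misstated notes), made importable and
three-way (the residual `ResidualOffPolarScope` cut into its two natures `C₂`, `C₃`).
-/

noncomputable section

-- every declaration of this problem lives in `Summit.HodgeConjecture.HodgeConjecture.…` (summit = sub-problem)
set_option linter.dupNamespace false

open CategoryTheory AlgebraicGeometry TopologicalSpace
open Literature.AlgebraicGeometry.Motives Literature.AlgebraicGeometry.HodgeTheory
open Summit.HodgeConjecture.HodgeConjecture.Theses.AnchorTransport

namespace Summit.HodgeConjecture.HodgeConjecture.Theorems

/-- The quasi-projectivity clause inlined in the children `C₁`, `C₂` (an open immersion of `𝒳` into a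
projective `ℂ`-scheme) is the tree's `IsQuasiProjectiveOver 𝒳` on the nose (Hartshorne II.4).
[folklore] -/
theorem codimSplit_isQuasiProjectiveOver_iff (𝒳 : SchemeOver ℂ) :
    (∃ (P : SchemeOver ℂ) (j : 𝒳 ⟶ P), IsProjectiveOver P ∧ IsOpenImmersion j.left) ↔
      IsQuasiProjectiveOver 𝒳 :=
  Iff.rfl

/-- **GLUE of the codimension split of the crux `VariationalHodge`.** If Grothendieck's variational Hodge
statement holds (`C₁`) in codimension `2` for smooth projective families with quasi-projective total
space over smooth irreducible affine bases, (`C₂`) in codimension `2` and relative dimension `n ≥ 4` for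
families with NON-quasi-projective total space over smooth irreducible affine curves, and (`C₃`) in
codimensions `3 ≤ p ≤ n - 2` over smooth irreducible affine curves, then it holds as filed — every smooth
proper family with projective fibres over every smooth irreducible base and every `p`: reduce to smooth
irreducible affine CURVE bases and to the middle range `2 ≤ p ≤ n - 2` (`variationalHodge_of_residual`:
outside that range the conclusion holds fibre by fibre by Lefschetz `(1,1)` and hard Lefschetz; two
complex points of a smooth irreducible affine base lie on a smooth irreducible affine curve mapping to
it, Mumford's lemma, and the data move along the base change — all three inputs are discharged theorems
of the tree), then split `p = 2` (quasi-projective total space or not; a smooth irreducible affine curve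
is a smooth irreducible affine base) from `3 ≤ p`. The hypotheses are the three children VERBATIM, so this
theorem is the `--glue-by` of the route split. [cite: CharlesSchnell2014Notes, Conj. 11.3.1 and Cor. 11.3.6]
[cite: VoisinHodgeI2002, Thm. 6.25 and Thm. 11.30] [cite: MumfordAV1970, §6 Lemma] -/
theorem variationalHodge_of_codimSplit :
    (∀ (n : ℕ) ⦃𝒳 S : Literature.AlgebraicGeometry.Motives.SchemeOver ℂ⦄ (f : 𝒳 ⟶ S), Literature.AlgebraicGeometry.Motives.IsSmoothProjectiveFamily f n → (∃ (P : Literature.AlgebraicGeometry.Motives.SchemeOver ℂ) (j : 𝒳 ⟶ P), Literature.AlgebraicGeometry.Motives.IsProjectiveOver P ∧ AlgebraicGeometry.IsOpenImmersion j.left) → IrreducibleSpace S.left → AlgebraicGeometry.IsAffine S.left → AlgebraicGeometry.Smooth S.hom → ∀ (A : Literature.AlgebraicGeometry.HodgeTheory.complexBetti 𝒳 (2 * 2)), (∀ s : Literature.AlgebraicGeometry.Motives.ComplexPoints S, Literature.AlgebraicGeometry.HodgeTheory.IsRationalClass (Literature.AlgebraicGeometry.HodgeTheory.complexBetti.map (Literature.AlgebraicGeometry.Motives.fiberι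 f s) (2 * 2) A) ∧ Literature.AlgebraicGeometry.HodgeTheory.IsOfHodgeType n (Literature.AlgebraicGeometry.Motives.fiberOver f s) (2 * 2) 2 2 (Literature.AlgebraicGeometry.HodgeTheory.complexBetti.map (Literature.AlgebraicGeometry.Motives.fiberι f s) (2 * 2) A)) → (∃ s₀ : Literature.AlgebraicGeometry.Motives.ComplexPoints S, Literature.AlgebraicGeometry.HodgeTheory.complexBetti.map (Literature.AlgebraicGeometry.Motives.fiberι f s₀) (2 * 2) A ∈ Literature.AlgebraicGeometry.HodgeTheory.algebraicClasses (Literature.AlgebraicGeometry.Motives.fiberOver f s₀) 2) → ∀ s : Literature.AlgebraicGeometry.Motives.ComplexPoints S, Literature.AlgebraicGeometry.HodgeTheory.complexBetti.map (Literature.AlgebraicGeometry.Motives.fiberι f s) (2 * 2) A ∈ Literature.AlgebraicGeometry.HodgeTheory.algebraicClasses (Literature.AlgebraicGeometry.Motives.fiberOver f s) 2) →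
    (∀ ⦃n : ℕ⦄ ⦃𝒳 S : Literature.AlgebraicGeometry.Motives.SchemeOver ℂ⦄ (f : 𝒳 ⟶ S), Literature.AlgebraicGeometry.Motives.IsSmoothProjectiveFamily f n → ¬ (∃ (P : Literature.AlgebraicGeometry.Motives.SchemeOver ℂ) (j : 𝒳 ⟶ P), Literature.AlgebraicGeometry.Motives.IsProjectiveOver P ∧ AlgebraicGeometry.IsOpenImmersion j.left) → IrreducibleSpace S.left → AlgebraicGeometry.IsAffine S.left → AlgebraicGeometry.Smooth S.hom → topologicalKrullDim S.left = 1 → 4 ≤ n → ∀ (A : Literature.AlgebraicGeometry.HodgeTheory.complexBetti 𝒳 (2 * 2)), (∀ s : Literature.AlgebraicGeometry.Motives.ComplexPoints S, Literature.AlgebraicGeometry.HodgeTheory.IsRationalClass (Literature.AlgebraicGeometry.HodgeTheory.complexBetti.map (Literature.AlgebraicGeometry.Motives.fiberι f s) (2 * 2) A) ∧ Literature.AlgebraicGeometry.HodgeTheory.IsOfHodgeType n (Literature.AlgebraicGeometry.Motives.fiberOver f s) (2 * 2) 2 2 (Literature.AlgebraicGeometry.HodgeTheory.complexBetti.map (Literature.AlgebraicGeometry.Motives.fiberι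 f s) (2 * 2) A)) → (∃ s₀ : Literature.AlgebraicGeometry.Motives.ComplexPoints S, Literature.AlgebraicGeometry.HodgeTheory.complexBetti.map (Literature.AlgebraicGeometry.Motives.fiberι f s₀) (2 * 2) A ∈ Literature.AlgebraicGeometry.HodgeTheory.algebraicClasses (Literature.AlgebraicGeometry.Motives.fiberOver f s₀) 2) → ∀ s : Literature.AlgebraicGeometry.Motives.ComplexPoints S, Literature.AlgebraicGeometry.HodgeTheory.complexBetti.map (Literature.AlgebraicGeometry.Motives.fiberι f s) (2 * 2) A ∈ Literature.AlgebraicGeometry.HodgeTheory.algebraicClasses (Literature.AlgebraicGeometry.Motives.fiberOver f s) 2) →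
    (∀ ⦃n : ℕ⦄ ⦃𝒳 S : Literature.AlgebraicGeometry.Motives.SchemeOver ℂ⦄ (f : 𝒳 ⟶ S), Literature.AlgebraicGeometry.Motives.IsSmoothProjectiveFamily f n → IrreducibleSpace S.left → AlgebraicGeometry.IsAffine S.left → AlgebraicGeometry.Smooth S.hom → topologicalKrullDim S.left = 1 → ∀ (p : ℕ), 3 ≤ p → p + 2 ≤ n → ∀ (A : Literature.AlgebraicGeometry.HodgeTheory.complexBetti 𝒳 (2 * p)), (∀ s : Literature.AlgebraicGeometry.Motives.ComplexPoints S, Literature.AlgebraicGeometry.HodgeTheory.IsRationalClass (Literature.AlgebraicGeometry.HodgeTheory.complexBetti.map (Literature.AlgebraicGeometry.Motives.fiberι f s) (2 * p) A) ∧ Literature.AlgebraicGeometry.HodgeTheory.IsOfHodgeType n (Literature.AlgebraicGeometry.Motives.fiberOver f s) (2 * p) p p (Literature.AlgebraicGeometry.HodgeTheory.complexBetti.map (Literature.AlgebraicGeometry.Motives.fiberι f s) (2 * p) A)) → (∃ s₀ : Literature.AlgebraicGeometry.Motives.ComplexPoints S, Literature.AlgebraicGeometry.HodgeTheory.complexBetti.map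 (Literature.AlgebraicGeometry.Motives.fiberι f s₀) (2 * p) A ∈ Literature.AlgebraicGeometry.HodgeTheory.algebraicClasses (Literature.AlgebraicGeometry.Motives.fiberOver f s₀) p) → ∀ s : Literature.AlgebraicGeometry.Motives.ComplexPoints S, Literature.AlgebraicGeometry.HodgeTheory.complexBetti.map (Literature.AlgebraicGeometry.Motives.fiberι f s) (2 * p) A ∈ Literature.AlgebraicGeometry.HodgeTheory.algebraicClasses (Literature.AlgebraicGeometry.Motives.fiberOver f s) p) →
    VariationalHodge := by
  intro h₁ h₂ h₃
  refine variationalHodge_of_residual lefschetzOneOne_rational_holds nonempty_hardLefschetzNFold_holds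
    mumford_smoothCurve_through_two_points_holds
    fun n 𝒳 S f hf hirr haff hsm hdim p hp2 hpn A hA hs₀ s => ?_
  rcases Nat.eq_or_lt_of_le hp2 with rfl | hp3
  · -- codimension 2: quasi-projective total space (`C₁`, the curve being an affine base) or not (`C₂`)
    by_cases hqp : ∃ (P : SchemeOver ℂ) (j : 𝒳 ⟶ P), IsProjectiveOver P ∧ IsOpenImmersion j.left
    · exact h₁ n f hf hqp hirr haff hsm A hA hs₀ s
    · exact h₂ f hf hqp hirr haff hsm hdim (by omega) A hA hs₀ s
  · -- codimension `3 ≤ p ≤ n - 2` (`C₃`)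
    exact h₃ f hf hirr haff hsm hdim p (by omega) hpn A hA hs₀ s

/-- **The codimension split is LOSSLESS**: the crux `VariationalHodge` is EQUIVALENT to the conjunction of
its three children — `→` is restriction (each child is the crux on a sub-class of data, so each is
implied by the crux and, like it, by `HodgeConjecture` fibrewise), `←` is `variationalHodge_of_codimSplit`.
In particular no child is stronger than the crux, and the three together are exactly as strong.
[cite: CharlesSchnell2014Notes, Conj. 11.3.1 and Cor. 11.3.6] -/
theorem variationalHodge_iff_codimSplit :
    VariationalHodge ↔
      ((∀ (n : ℕ) ⦃𝒳 S : Literature.AlgebraicGeometry.Motives.SchemeOver ℂ⦄ (f : 𝒳 ⟶ S), Literature.AlgebraicGeometry.Motives.IsSmoothProjectiveFamily f n → (∃ (P : Literature.AlgebraicGeometry.Motives.SchemeOver ℂ) (j : 𝒳 ⟶ P), Literature.AlgebraicGeometry.Motives.IsProjectiveOver P ∧ AlgebraicGeometry.IsOpenImmersion j.left) → IrreducibleSpace S.left → AlgebraicGeometry.IsAffine S.left → AlgebraicGeometry.Smooth S.hom → ∀ (A : Literature.AlgebraicGeometry.HodgeTheory.complexBetti 𝒳 (2 * 2)), (∀ s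 : Literature.AlgebraicGeometry.Motives.ComplexPoints S, Literature.AlgebraicGeometry.HodgeTheory.IsRationalClass (Literature.AlgebraicGeometry.HodgeTheory.complexBetti.map (Literature.AlgebraicGeometry.Motives.fiberι f s) (2 * 2) A) ∧ Literature.AlgebraicGeometry.HodgeTheory.IsOfHodgeType n (Literature.AlgebraicGeometry.Motives.fiberOver f s) (2 * 2) 2 2 (Literature.AlgebraicGeometry.HodgeTheory.complexBetti.map (Literature.AlgebraicGeometry.Motives.fiberι f s) (2 * 2) A)) → (∃ s₀ : Literature.AlgebraicGeometry.Motives.ComplexPoints S, Literature.AlgebraicGeometry.HodgeTheory.complexBetti.map (Literature.AlgebraicGeometry.Motives.fiberι f s₀) (2 * 2) A ∈ Literature.AlgebraicGeometry.HodgeTheory.algebraicClasses (Literature.AlgebraicGeometry.Motives.fiberOver f s₀) 2) → ∀ s : Literature.AlgebraicGeometry.Motives.ComplexPoints S, Literature.AlgebraicGeometry.HodgeTheory.complexBetti.map (Literature.AlgebraicGeometry.Motives.fiberι f s) (2 * 2) A ∈ Literature.AlgebraicGeometry.HodgeTheory.algebraicClasses (Literature.AlgebraicGeometry.Motives.fiberOver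 f s) 2) ∧
       (∀ ⦃n : ℕ⦄ ⦃𝒳 S : Literature.AlgebraicGeometry.Motives.SchemeOver ℂ⦄ (f : 𝒳 ⟶ S), Literature.AlgebraicGeometry.Motives.IsSmoothProjectiveFamily f n → ¬ (∃ (P : Literature.AlgebraicGeometry.Motives.SchemeOver ℂ) (j : 𝒳 ⟶ P), Literature.AlgebraicGeometry.Motives.IsProjectiveOver P ∧ AlgebraicGeometry.IsOpenImmersion j.left) → IrreducibleSpace S.left → AlgebraicGeometry.IsAffine S.left → AlgebraicGeometry.Smooth S.hom → topologicalKrullDim S.left = 1 → 4 ≤ n → ∀ (A : Literature.AlgebraicGeometry.HodgeTheory.complexBetti 𝒳 (2 * 2)), (∀ s : Literature.AlgebraicGeometry.Motives.ComplexPoints S, Literature.AlgebraicGeometry.HodgeTheory.IsRationalClass (Literature.AlgebraicGeometry.HodgeTheory.complexBetti.map (Literature.AlgebraicGeometry.Motives.fiberι f s) (2 * 2) A) ∧ Literature.AlgebraicGeometry.HodgeTheory.IsOfHodgeType n (Literature.AlgebraicGeometry.Motives.fiberOver f s) (2 * 2) 2 2 (Literature.AlgebraicGeometry.HodgeTheory.complexBetti.map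 (Literature.AlgebraicGeometry.Motives.fiberι f s) (2 * 2) A)) → (∃ s₀ : Literature.AlgebraicGeometry.Motives.ComplexPoints S, Literature.AlgebraicGeometry.HodgeTheory.complexBetti.map (Literature.AlgebraicGeometry.Motives.fiberι f s₀) (2 * 2) A ∈ Literature.AlgebraicGeometry.HodgeTheory.algebraicClasses (Literature.AlgebraicGeometry.Motives.fiberOver f s₀) 2) → ∀ s : Literature.AlgebraicGeometry.Motives.ComplexPoints S, Literature.AlgebraicGeometry.HodgeTheory.complexBetti.map (Literature.AlgebraicGeometry.Motives.fiberι f s) (2 * 2) A ∈ Literature.AlgebraicGeometry.HodgeTheory.algebraicClasses (Literature.AlgebraicGeometry.Motives.fiberOver f s) 2) ∧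
       (∀ ⦃n : ℕ⦄ ⦃𝒳 S : Literature.AlgebraicGeometry.Motives.SchemeOver ℂ⦄ (f : 𝒳 ⟶ S), Literature.AlgebraicGeometry.Motives.IsSmoothProjectiveFamily f n → IrreducibleSpace S.left → AlgebraicGeometry.IsAffine S.left → AlgebraicGeometry.Smooth S.hom → topologicalKrullDim S.left = 1 → ∀ (p : ℕ), 3 ≤ p → p + 2 ≤ n → ∀ (A : Literature.AlgebraicGeometry.HodgeTheory.complexBetti 𝒳 (2 * p)), (∀ s : Literature.AlgebraicGeometry.Motives.ComplexPoints S, Literature.AlgebraicGeometry.HodgeTheory.IsRationalClass (Literature.AlgebraicGeometry.HodgeTheory.complexBetti.map (Literature.AlgebraicGeometry.Motives.fiberι f s) (2 * p) A) ∧ Literature.AlgebraicGeometry.HodgeTheory.IsOfHodgeType n (Literature.AlgebraicGeometry.Motives.fiberOver f s) (2 * p) p p (Literature.AlgebraicGeometry.HodgeTheory.complexBetti.map (Literature.AlgebraicGeometry.Motives.fiberι f s) (2 * p) A)) → (∃ s₀ : Literature.AlgebraicGeometry.Motives.ComplexPoints S, Literature.AlgebraicGeometry.HodgeTheory.complexBetti.map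 (Literature.AlgebraicGeometry.Motives.fiberι f s₀) (2 * p) A ∈ Literature.AlgebraicGeometry.HodgeTheory.algebraicClasses (Literature.AlgebraicGeometry.Motives.fiberOver f s₀) p) → ∀ s : Literature.AlgebraicGeometry.Motives.ComplexPoints S, Literature.AlgebraicGeometry.HodgeTheory.complexBetti.map (Literature.AlgebraicGeometry.Motives.fiberι f s) (2 * p) A ∈ Literature.AlgebraicGeometry.HodgeTheory.algebraicClasses (Literature.AlgebraicGeometry.Motives.fiberOver f s) p)) := by
  constructor
  · intro hV
    exact ⟨fun n 𝒳 S f hf _ hirr _ hsm A hA hs₀ s => hV f hf hirr hsm 2 A hA hs₀ s,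
      fun n 𝒳 S f hf _ hirr _ hsm _ _ A hA hs₀ s => hV f hf hirr hsm 2 A hA hs₀ s,
      fun n 𝒳 S f hf hirr _ hsm _ p _ _ A hA hs₀ s => hV f hf hirr hsm p A hA hs₀ s⟩
  · rintro ⟨h₁, h₂, h₃⟩
    exact variationalHodge_of_codimSplit h₁ h₂ h₃

end Summit.HodgeConjecture.HodgeConjecture.Theorems

end
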